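import Summits.QuantumFields.BalabanUV.T4Continuum.Support.ShellMeasureLogConcaveDetSUN

/-!
# `T4Continuum.ShellMeasureLogConcaveJacobianSUN` — the windowed `SU(N)` exponential-chart Haar Jacobian
# `1_{‖v‖ ≤ S}·J`, `J = det T_v = |det T_v| = jacM`, and the block chart weight `1_{‖x‖ ≤ S}·∏_b J(x_b)` (`0 ≤ S ≤ π`) are
# LOG-CONCAVE WEIGHTS — row S3's «Haar Jacobian … log-concave» in member (λ)'s currency, the `SU(N)` twin of
# `ShellMeasureLogConcaveJacobian.isLogConcaveWeight_chartWeight` (`SU(2)`, cube `3S² < π²`)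
# (cell `pub-balaban`, sub-cell `t4`, spine estimate NE7c (node U5b); ROUND-2 crew `t4-ne7c-formalise-*`, seat
# `b2b-balaban-t4-ne7c-formalise-leaf-04` (gen 2); row S3 «SM-L9 SU(N) chart» (trigger c5: optional and last — `SU(2)` is
# the row's certified instance); companion of `ShellMeasureLogConcaveDetSUN` (the mathematics: `log det T_v` concave on
# `‖v‖ ≤ π`), which it imports and ONLY imports; modifies nothing; 0 `def`, 0 sorry, 0 citations, no `def … : Prop`)

HONEST FRAMING.  Finite four-torus programme, rung (B)+1 only — NOT infinite volume, NOT a mass gap, NOT the Clay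
problem, NOT summit progress.  Nothing of [Balaban 1983–89] is asserted; everything is [folklore] kernel bookkeeping over
the companion's three-point inequality and the tree's `IsLogConcaveWeight` closure lemmas.  The cell wall of NE7c — (M1)
FOR BAŁABAN'S INDUCTIVELY DEFINED EFFECTIVE MEASURES at live levels ⇐ SM-L1/SM-L4/SM-L6 + node U1b's rate — is NOT
PRINTED (GAPS G-ne7cp1-1) and NOT moved; member (λ) (`ShellMeasureLogConcave`, lineage P1 gen 24) rests on the located
DESIGN reading (λ-1) «convex classifiers»; NOTHING in the countdown moves (spine PROVED 0/9); «NE7c ⇐ the named binders»,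
never «NE7c proved».  HONEST DEPENDENCY (cell, verbatim): continuum YM on T⁴ ⇐ BetaPertH ∧ nine spine estimates (0/9
proved); BetaPertH ⇐ (D1) ∧ (D4) ∧ CAP+tail; G-an2-4 gates asym, D1 and NE2/3/4.

THE POINTS (all [folklore]).
* `jacM_eq_ofReal_det`: the (CH)₁ line's area-formula Jacobian IS `det T_v` as an `ℝ≥0∞` weight (`jacM_eq_abs_det`,
  `det T_v ≥ 0`) — the CONTINUOUS representative of the a.e.-class of S3 f4's `expJacSU` (`jacM_ae_eq_expJacSU`; the
  determinant quotient `expJacSU` itself vanishes on the non-regular cone and is not log-concave as a function; chart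
  LAWS built from either weight coincide).
* **`isLogConcaveWeight_indicator_jacM`**: `1_{‖v‖ ≤ S}·J` is an `IsLogConcaveWeight` on `ChartSU N` for every `S ≤ π`
  (`ShellMeasureLogConcaveDetSUN.det_duhT_threePoint` + convexity of the ball).
* closure under products over the bonds: `isLogConcaveWeight_const`, `isLogConcaveWeight_comp_eval`,
  `isLogConcaveWeight_pi_prod` (finite products of log-concave one-coordinate weights on a product space).
* **`isLogConcaveWeight_chartWeightSU_jacM`**: S3 f1's block chart weight `ShellMeasureExpChartSUN.chartWeightSU Λ S jacM
  = 1_{‖x‖ ≤ S}·∏_b J(x_b)` on `BlockChartSU N Λ` is an `IsLogConcaveWeight` for `0 ≤ S ≤ π`; the same for the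
  normalised one-bond weight `κ·J` (`isLogConcaveWeight_chartWeightSU_smul_jacM`; `κ = κ_N` of (CH)₁).
CONSEQUENCE for member (λ) on the `SU(N)` road: by `ShellMeasureLogConcave.isLogConcaveWeight_mul`, hypothesis (C-ii)
(log-concavity of the chart-side sectioned weight = window·Jacobian·block weight) may be asked of the BLOCK WEIGHT ALONE,
exactly as `ShellMeasureLogConcaveJacobian` §3 arranged it for `SU(2)`.

WHAT THIS DOES NOT DO.  The `SU(N)` REALIZED member-(λ) headline (twin of
`ShellMeasureLogConcaveJacobian.slotAntiConcentration_realized_su2_of_logConcave_blockWeight`) is NOT assembled here — it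
needs the Prékopa–Leindler engine `ShellMeasureLogConcave.slotAntiConcentration_of_logConcave` (typed on `Fin n → ℝ`)
transported to the block chart space, a separate leaf; no instance of (C-i)/(C-ii)/(C-iii) for Bałaban's sectioned block
weights or classifiers; (Det), (FI-sat), (LR), (MR), (W1), the (F∞)-rate keep their status.  NE7c NOT proved.
-/

noncomputable section

namespace Summit.QuantumFields.BalabanUV.T4Continuum.ShellMeasureLogConcaveJacobianSUN

open MeasureTheory Set Function Finset Matrix Metric
open scoped ENNReal
open Literature.MathematicalPhysics.QuantumFieldTheory.Balaban1983to89
open ShellMeasureExpChartSUN (ChartSU BlockChartSU chartWeightSU chartWeightSU_eq_prod_indicator)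
open ShellMeasureExpDuhamelSUN (duhT genSU_duhT_eq_integral)
open ShellMeasureExpDuhamelDetSUN (det_mem_Icc)
open ShellMeasureExpHaarAreaSUN (jacM jacM_eq_abs_det)
open ShellMeasureLogConcave (IsLogConcaveWeight isLogConcaveWeight_mul)
open ShellMeasureLogConcaveDetSUN (det_duhT_threePoint)

/-! ## §5 Packaging in member (λ)'s currency: the windowed Jacobian weights are `IsLogConcaveWeight` -/

section Weight

variable {N : ℕ}

/-- `J(v) = det T_v` as an `ℝ≥0∞` weight (`jacM_eq_abs_det`, `det T_v ≥ 0`). [folklore] -/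
theorem jacM_eq_ofReal_det (v : ChartSU N) :
    jacM v = ENNReal.ofReal (LinearMap.det (duhT v : ChartSU N →ₗ[ℝ] ChartSU N)) := by
  rw [jacM_eq_abs_det, abs_of_nonneg (det_mem_Icc _ (genSU_duhT_eq_integral v)).1]

/-- **THE WINDOWED `SU(N)` CHART JACOBIAN `1_{‖v‖ ≤ S}·J` IS A LOG-CONCAVE WEIGHT ON `ChartSU N`** for every window radius
`S ≤ π`. [folklore] -/
theorem isLogConcaveWeight_indicator_jacM {S : ℝ} (hS : S ≤ Real.pi) :
    IsLogConcaveWeight ((closedBall (0 : ChartSU N) S).indicator (jacM (N := N))) := by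
  intro x y s hs0 hs1
  have h1s : 0 < 1 - s := by linarith
  by_cases hx : x ∈ closedBall (0 : ChartSU N) S
  · by_cases hy : y ∈ closedBall (0 : ChartSU N) S
    · have hz : (1 - s) • x + s • y ∈ closedBall (0 : ChartSU N) S :=
        (convex_closedBall _ _) hx hy h1s.le hs0.le (by ring)
      have hxπ : ‖x‖ ≤ Real.pi := (mem_closedBall_zero_iff.mp hx).trans hS
      have hyπ : ‖y‖ ≤ Real.pi := (mem_closedBall_zero_iff.mp hy).trans hS
      rw [indicator_of_mem hx, indicator_of_mem hy, indicator_of_mem hz, jacM_eq_ofReal_det, jacM_eq_ofReal_det,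
        jacM_eq_ofReal_det,
        ENNReal.ofReal_rpow_of_nonneg (det_mem_Icc _ (genSU_duhT_eq_integral x)).1 h1s.le,
        ENNReal.ofReal_rpow_of_nonneg (det_mem_Icc _ (genSU_duhT_eq_integral y)).1 hs0.le,
        ← ENNReal.ofReal_mul (Real.rpow_nonneg (det_mem_Icc _ (genSU_duhT_eq_integral x)).1 _)]
      exact ENNReal.ofReal_le_ofReal (det_duhT_threePoint hxπ hyπ h1s.le hs0.le (by ring))
    · rw [indicator_of_notMem hy, ENNReal.zero_rpow_of_pos hs0, mul_zero]
      exact bot_le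
  · rw [indicator_of_notMem hx, ENNReal.zero_rpow_of_pos h1s, zero_mul]
    exact bot_le

/-- a CONSTANT weight is log-concave. [folklore] -/
theorem isLogConcaveWeight_const {E : Type*} [AddCommGroup E] [Module ℝ E] (c : ℝ≥0∞) :
    IsLogConcaveWeight fun _ : E => c := by
  intro x y s hs0 hs1
  have h1s : 0 < 1 - s := by linarith
  rcases eq_or_ne c 0 with rfl | hc0
  · rw [ENNReal.zero_rpow_of_pos hs0, mul_zero]
  rcases eq_or_ne c ∞ with rfl | hctop
  · exact le_top
  rw [← ENNReal.rpow_add _ _ hc0 hctop, sub_add_cancel, ENNReal.rpow_one]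

/-- a log-concave weight read through one COORDINATE of a product space is log-concave. [folklore] -/
theorem isLogConcaveWeight_comp_eval {ι E : Type*} [AddCommGroup E] [Module ℝ E] {w : E → ℝ≥0∞}
    (hw : IsLogConcaveWeight w) (b : ι) : IsLogConcaveWeight fun x : ι → E => w (x b) :=
  fun x y _ hs0 hs1 => hw (x b) (y b) hs0 hs1

/-- **FINITE PRODUCTS OF LOG-CONCAVE ONE-COORDINATE WEIGHTS ARE LOG-CONCAVE** on the product space. [folklore] -/
theorem isLogConcaveWeight_pi_prod {ι E : Type*} [Fintype ι] [AddCommGroup E] [Module ℝ E] {w : ι → E → ℝ≥0∞}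
    (hw : ∀ b, IsLogConcaveWeight (w b)) : IsLogConcaveWeight fun x : ι → E => ∏ b, w b (x b) := by
  classical
  suffices h : ∀ s : Finset ι, IsLogConcaveWeight fun x : ι → E => ∏ b ∈ s, w b (x b) from h Finset.univ
  intro s
  induction s using Finset.induction_on with
  | empty =>
    simp only [Finset.prod_empty]
    exact isLogConcaveWeight_const 1
  | insert a s ha ih =>
    simp only [Finset.prod_insert ha]
    exact isLogConcaveWeight_mul (isLogConcaveWeight_comp_eval (hw a) a) ih

variable {P : Params} {j : ℕ} (Λ : Finset (PBond P j))

/-- **THE `SU(N)` BLOCK CHART WEIGHT `1_{‖x‖ ≤ S}·∏_b J(x_b)` IS A LOG-CONCAVE WEIGHT ON THE BLOCK CHART SPACE** for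
`0 ≤ S ≤ π` — row S3's «Haar Jacobian … log-concave», the `SU(N)` twin of
`ShellMeasureLogConcaveJacobian.isLogConcaveWeight_chartWeight` (`SU(2)`, cube `3S² < π²`): on the `SU(N)` road member
(λ)'s hypothesis (C-ii) may be asked of the BLOCK WEIGHT ALONE (`ShellMeasureLogConcave.isLogConcaveWeight_mul`).
[folklore] -/
theorem isLogConcaveWeight_chartWeightSU_jacM {S : ℝ} (hS0 : 0 ≤ S) (hS : S ≤ Real.pi) :
    IsLogConcaveWeight (chartWeightSU (N := N) Λ S jacM) := by
  have heq : chartWeightSU (N := N) Λ S jacM =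
      fun x : BlockChartSU N Λ => ∏ b, (closedBall (0 : ChartSU N) S).indicator jacM (x b) :=
    funext fun x => chartWeightSU_eq_prod_indicator Λ hS0 jacM x
  rw [heq]
  exact isLogConcaveWeight_pi_prod fun _ => isLogConcaveWeight_indicator_jacM hS

/-- the same for the NORMALISED one-bond weight `κ·J` (e.g. `κ = κ_N` of (CH)₁): constants are free. [folklore] -/
theorem isLogConcaveWeight_chartWeightSU_smul_jacM (κ : ℝ≥0∞) {S : ℝ} (hS0 : 0 ≤ S) (hS : S ≤ Real.pi) :
    IsLogConcaveWeight (chartWeightSU (N := N) Λ S fun v => κ * jacM v) := by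
  have heq : chartWeightSU (N := N) Λ S (fun v => κ * jacM v) =
      fun x : BlockChartSU N Λ => ∏ b, (closedBall (0 : ChartSU N) S).indicator (fun v => κ * jacM v) (x b) :=
    funext fun x => chartWeightSU_eq_prod_indicator Λ hS0 _ x
  have hind : (closedBall (0 : ChartSU N) S).indicator (fun v => κ * jacM v) =
      fun v => κ * (closedBall (0 : ChartSU N) S).indicator jacM v := by
    funext v
    by_cases hv : v ∈ closedBall (0 : ChartSU N) S
    · rw [indicator_of_mem hv, indicator_of_mem hv]
    · rw [indicator_of_notMem hv, indicator_of_notMem hv, mul_zero]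
  rw [heq, hind]
  exact isLogConcaveWeight_pi_prod fun _ =>
    isLogConcaveWeight_mul (isLogConcaveWeight_const κ) (isLogConcaveWeight_indicator_jacM hS)

end Weight

end Summit.QuantumFields.BalabanUV.T4Continuum.ShellMeasureLogConcaveJacobianSUN
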